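import Mathlib.Analysis.InnerProductSpace.l2Space
import Mathlib.Topology.Metrizable.Basic
import Literature.Analysis.FunctionSpaces.TorusTrigPoly
import HarnessLib

/-!
# The real Hilbert space of conjugation-symmetric square-summable coefficient families on `ℤ^d`

Analysis/FunctionSpaces support file for the energy-method (Kato–Lai 1984, Thm A, in the tree as
`Literature.Analysis.FluidPDE.KatoLai.thmA_form`) construction of Euler flows in the periodic
cylinder (`Literature.Analysis.FluidPDE.KatoLai1984_periodicCylinderUniformExistence`), which is
run on the flat torus `T^d` in **Fourier variables**. Real vector fields `u : T^d → ℝ^d` are the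
fields whose coefficient families `û = 𝓕(complexify ∘ u) : ℤ^d → ℂ^d` are conjugation symmetric
(`Torus.IsConjSymm`, `û(-k) = conj û(k)`; `Torus.isConjSymm_mFourierCoeff`), and every Sobolev
space `H^s(T^d; ℝ^d)` is, through `k ↦ ⟨k⟩^s û(k)`, the same real Hilbert space: the
conjugation-symmetric part of `ℓ²(ℤ^d; ℂ^d)`. This file builds that one carrier:

* `Torus.SqFam d` — `ℓ²(ℤ^d; ℂ^d)` (Mathlib's `lp … 2`) regarded as a **real** Hilbert space
  (`InnerProductSpace.complexToReal`: `⟪f, g⟫_ℝ = Re ∑_k ⟪f k, g k⟫_ℂ`; a type synonym, so no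
  instance diamond arises), complete and separable (`SqFam.separableSpace`: the real span of the
  one-mode families `lp.single` is dense, `lp.hasSum_single`);
* `Torus.symL2 d` — the closed real submodule of conjugation-symmetric families and the real
  Hilbert space `Torus.SymL2 d` (complete, separable, inner product inherited);
* `Torus.SqFam.diag m` / `Torus.SymL2.diag m` — the **diagonal multipliers** by bounded (even)
  real symbols `m`, as continuous linear maps, with the coordinate formula, the norm identity
  `‖diag m f‖² = ∑ m(k)² ‖f k‖²`, composition, injectivity for non-vanishing symbols;
* `Torus.SymL2.trunc N` — Fourier truncation to the frequency ball `freqBall N` (a diagonal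
  multiplier), `trunc N f → f` (`SymL2.tendsto_trunc`), finitely supported elements
  (`SymL2.ofFinSupp`) and the **dense range** of every non-vanishing even multiplier
  (`SymL2.denseRange_diag`) — the inclusions `V ⊂ H` of the Galerkin triplet are such multipliers.

Everything is proved; no named fact and no `sorry` is introduced.

## Mathlib / tree search

Mathlib: `lp`, `lp.instInnerProductSpace`, `lp.hasSum_norm`, `lp.hasSum_inner`, `lp.single`,
`lp.hasSum_single`, `lp.norm_apply_le_norm`, `memℓp_gen`, `InnerProductSpace.complexToReal`,
`TopologicalSpace.IsSeparable.span`, `IsSeparable.separableSpace`, `LinearMap.mkContinuous`,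
`ContinuousLinearMap.codRestrict`. Tree: `Torus.IsConjSymm`, `EuclideanSpace.conjVec`,
`Torus.freqBall`, `Torus.tendsto_freqBall_atTop` (`TorusTrigPoly`); the tree's
`TorusSobolev s d F` (`TorusSobolevSpace`) is the complex, non-symmetric version of the same
carrier (no real structure, no multipliers); `lean search 'SymL2|IsConjSymm.*lp|complexToReal'`
finds nothing else.

## References

* T. Kato, C. Y. Lai, *Nonlinear evolution equations and the Euler flow*, J. Funct. Anal. 56
  (1984) 15–28, §3 (real separable Hilbert spaces `V ⊂ H`). [KatoLai1984]
* L. Grafakos, *Classical Fourier Analysis*, 3rd ed., Springer 2014, §3.1–3.3 (Fourier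
  coefficients on the torus, Plancherel). [Grafakos2014]
-/

noncomputable section

open Filter Topology TopologicalSpace Finset
open scoped ENNReal NNReal ComplexConjugate InnerProductSpace

namespace Literature.Analysis.FunctionSpaces

namespace Torus

universe u

variable (d : Type u) [Fintype d]

/-! ### `ℓ²(ℤ^d; ℂ^d)` as a real Hilbert space -/

/-- **`ℓ²(ℤ^d; ℂ^d)` with real scalars**: a type synonym of Mathlib's `lp (fun _ : ℤ^d ↦ ℂ^d) 2`
carrying the real inner product `⟪f, g⟫_ℝ = Re ∑_k ⟪f k, g k⟫_ℂ`. [folklore] -/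
def SqFam : Type u := lp (fun _ : d → ℤ => EuclideanSpace ℂ d) 2

namespace SqFam

variable {d}

/-- The underlying `ℓ²` element. [folklore] -/
def toLp (f : SqFam d) : lp (fun _ : d → ℤ => EuclideanSpace ℂ d) 2 := f

/-- An `ℓ²` element regarded in `SqFam`. [folklore] -/
def ofLp (f : lp (fun _ : d → ℤ => EuclideanSpace ℂ d) 2) : SqFam d := f

/-- The normed group structure of `ℓ²`. [folklore] -/
instance : NormedAddCommGroup (SqFam d) :=
  inferInstanceAs (NormedAddCommGroup (lp (fun _ : d → ℤ => EuclideanSpace ℂ d) 2))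

/-- The complex inner product space structure of `ℓ²` (used only to define the real one). [folklore] -/
@[reducible] def complexIPS : InnerProductSpace ℂ (SqFam d) :=
  inferInstanceAs (InnerProductSpace ℂ (lp (fun _ : d → ℤ => EuclideanSpace ℂ d) 2))

/-- **The real inner product** `⟪f, g⟫_ℝ = Re ⟪f, g⟫_ℂ` (`InnerProductSpace.complexToReal`). [folklore] -/
instance : InnerProductSpace ℝ (SqFam d) := @InnerProductSpace.complexToReal (SqFam d) _ complexIPS

/-- `ℓ²` is complete. [folklore] -/
instance : CompleteSpace (SqFam d) :=
  inferInstanceAs (CompleteSpace (lp (fun _ : d → ℤ => EuclideanSpace ℂ d) 2))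

/-- The coefficient family of an element. [folklore] -/
@[coe] def coeFn (f : SqFam d) : (d → ℤ) → EuclideanSpace ℂ d := (f.toLp : ∀ _ : d → ℤ, EuclideanSpace ℂ d)

/-- Elements are coefficient families. [folklore] -/
instance : CoeFun (SqFam d) fun _ => (d → ℤ) → EuclideanSpace ℂ d := ⟨coeFn⟩

/-- Two elements with the same coefficients are equal. [folklore] -/
@[ext] theorem ext {f g : SqFam d} (h : ∀ k, f k = g k) : f = g :=
  lp.ext (funext h)

/-- Coefficients of a sum. [folklore] -/
@[simp] theorem add_apply (f g : SqFam d) (k : d → ℤ) : (f + g) k = f k + g k := rfl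

/-- Coefficients of a difference. [folklore] -/
@[simp] theorem sub_apply (f g : SqFam d) (k : d → ℤ) : (f - g) k = f k - g k := rfl

/-- Coefficients of a negative. [folklore] -/
@[simp] theorem neg_apply (f : SqFam d) (k : d → ℤ) : (-f) k = -f k := rfl

/-- Coefficients of zero. [folklore] -/
@[simp] theorem zero_apply (k : d → ℤ) : (0 : SqFam d) k = 0 := rfl

/-- **Real scalars act through `ℂ`**: `(c • f) k = (c : ℂ) • f k`. [folklore] -/
@[simp] theorem smul_apply (c : ℝ) (f : SqFam d) (k : d → ℤ) : (c • f) k = (c : ℂ) • f k := rfl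

/-- Coefficients of a finite sum. [folklore] -/
@[simp] theorem sum_apply {ι : Type*} (s : Finset ι) (f : ι → SqFam d) (k : d → ℤ) :
    (∑ i ∈ s, f i) k = ∑ i ∈ s, f i k := by
  induction s using Finset.cons_induction with
  | empty => rfl
  | cons a s ha ih => rw [sum_cons, sum_cons, add_apply, ih]

/-- The coefficient family is square summable. [folklore] -/
theorem summable_norm_sq (f : SqFam d) : Summable fun k => ‖f k‖ ^ 2 := by
  have h2 : Summable fun k => ‖f k‖ ^ (2 : ℝ≥0∞).toReal :=
    (memℓp_gen_iff (by norm_num : 0 < (2 : ℝ≥0∞).toReal)).1 (lp.memℓp f.toLp)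
  simpa using h2

/-- **The norm**: `‖f‖² = ∑_k ‖f k‖²`. [folklore] -/
theorem hasSum_norm_sq (f : SqFam d) : HasSum (fun k => ‖f k‖ ^ 2) (‖f‖ ^ 2) := by
  have h := lp.hasSum_norm (by norm_num : 0 < (2 : ℝ≥0∞).toReal) f.toLp
  simp only [ENNReal.toReal_ofNat, Real.rpow_ofNat] at h
  exact h

/-- `‖f‖² = ∑' ‖f k‖²`. [folklore] -/
theorem norm_sq_eq_tsum (f : SqFam d) : ‖f‖ ^ 2 = ∑' k, ‖f k‖ ^ 2 := (hasSum_norm_sq f).tsum_eq.symm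

/-- Each coefficient is bounded by the norm. [folklore] -/
theorem norm_apply_le (f : SqFam d) (k : d → ℤ) : ‖f k‖ ≤ ‖f‖ :=
  lp.norm_apply_le_norm (by norm_num) f.toLp k

/-- The evaluation maps are continuous (indeed `1`-Lipschitz). [folklore] -/
theorem continuous_apply (k : d → ℤ) : Continuous fun f : SqFam d => f k := by
  refine continuous_iff_continuousAt.2 fun f => ?_
  refine (LipschitzWith.continuous (K := 1) (LipschitzWith.of_dist_le_mul fun f g => ?_)).continuousAt
  rw [NNReal.coe_one, one_mul, dist_eq_norm, dist_eq_norm, ← sub_apply]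
  exact norm_apply_le _ _

/-- **The real inner product**: `⟪f, g⟫_ℝ = ∑_k Re ⟪f k, g k⟫_ℂ`. [folklore] -/
theorem hasSum_inner (f g : SqFam d) : HasSum (fun k => RCLike.re (⟪f k, g k⟫_ℂ)) ⟪f, g⟫_ℝ := by
  have h : HasSum (fun k => ⟪f k, g k⟫_ℂ) (@inner ℂ (SqFam d) complexIPS.toInner f g) :=
    lp.hasSum_inner (𝕜 := ℂ) f.toLp g.toLp
  exact Complex.reCLM.hasSum h

/-- `⟪f, g⟫_ℝ = ∑' Re ⟪f k, g k⟫_ℂ`. [folklore] -/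
theorem inner_eq_tsum (f g : SqFam d) : ⟪f, g⟫_ℝ = ∑' k, RCLike.re (⟪f k, g k⟫_ℂ) :=
  (hasSum_inner f g).tsum_eq.symm

/-- **Elements from square-summable families.** [folklore] -/
def mk (c : (d → ℤ) → EuclideanSpace ℂ d) (hc : Summable fun k => ‖c k‖ ^ 2) : SqFam d :=
  ofLp ⟨c, memℓp_gen (by simpa using hc)⟩

/-- Coefficients of `mk`. [folklore] -/
@[simp] theorem mk_apply (c : (d → ℤ) → EuclideanSpace ℂ d) (hc : Summable fun k => ‖c k‖ ^ 2) (k : d → ℤ) :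
    mk c hc k = c k := rfl

/-- A finitely supported family is square summable. [folklore] -/
theorem summable_sq_of_support_subset {c : (d → ℤ) → EuclideanSpace ℂ d} {S : Finset (d → ℤ)}
    (hS : ∀ k ∉ S, c k = 0) : Summable fun k => ‖c k‖ ^ 2 :=
  summable_of_ne_finset_zero (s := S) fun k hk => by rw [hS k hk, norm_zero]; ring

/-- The one-mode families `lp.single`, in `SqFam`. [folklore] -/
def single (k : d → ℤ) (a : EuclideanSpace ℂ d) : SqFam d := ofLp (lp.single 2 k a)

/-- Coefficients of a one-mode family. [folklore] -/
theorem single_apply (k : d → ℤ) (a : EuclideanSpace ℂ d) (l : d → ℤ) :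
    single k a l = if l = k then a else 0 := by
  classical
  show (lp.single 2 k a : ∀ _ : d → ℤ, EuclideanSpace ℂ d) l = _
  rw [lp.coeFn_single, Pi.single_apply]

/-! ### Separability -/

/-- **`ℓ²(ℤ^d; ℂ^d)` is separable** (the real span of the one-mode families is dense).
[folklore] -/
instance separableSpace : SeparableSpace (SqFam d) := by
  classical
  -- the one-mode maps are isometries of `ℓ²`, in particular continuous
  have hcont : ∀ k : d → ℤ, Continuous fun a : EuclideanSpace ℂ d =>
      (lp.single 2 k a : lp (fun _ : d → ℤ => EuclideanSpace ℂ d) 2) := by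
    intro k
    refine (LipschitzWith.of_dist_le_mul (K := 1) fun a b => ?_).continuous
    have hsub : lp.single 2 k a - lp.single 2 k b = (lp.single 2 k (a - b) : lp (fun _ : d → ℤ => EuclideanSpace ℂ d) 2) := by
      rw [sub_eq_add_neg, ← lp.single_neg, ← lp.single_add, ← sub_eq_add_neg]
    have hns : ‖(lp.single 2 k (a - b) : lp (fun _ : d → ℤ => EuclideanSpace ℂ d) 2)‖ = ‖a - b‖ :=
      lp.norm_single (E := fun _ : d → ℤ => EuclideanSpace ℂ d) (p := 2) zero_lt_two k (a - b)
    rw [NNReal.coe_one, one_mul, dist_eq_norm, dist_eq_norm, hsub, hns]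
  -- the separable generating set
  let s : Set (SqFam d) := ⋃ k : d → ℤ, Set.range (fun a : EuclideanSpace ℂ d => single k a)
  have hsep : IsSeparable s := isSeparable_iUnion.2 fun k => isSeparable_range (hcont k)
  have hspan : IsSeparable ((Submodule.span ℝ s : Submodule ℝ (SqFam d)) : Set (SqFam d)) := hsep.span
  -- every element is a limit of finite sums of one-mode families
  have hdense : (Set.univ : Set (SqFam d)) ⊆ closure (Submodule.span ℝ s : Set (SqFam d)) := by
    intro f _
    have hsum : HasSum (fun k : d → ℤ => single k (f k)) f := lp.hasSum_single (by norm_num) f.toLp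
    have ht : Tendsto (fun t : Finset (d → ℤ) => ∑ k ∈ t, single k (f k)) atTop (𝓝 f) := hsum
    refine mem_closure_of_tendsto ht (Eventually.of_forall fun t => ?_)
    exact Submodule.sum_mem _ fun k _ => Submodule.subset_span (Set.mem_iUnion.2 ⟨k, Set.mem_range_self _⟩)
  exact isSeparable_univ_iff.1 ((hspan.closure).mono hdense)

/-! ### Diagonal multipliers -/

section Diag

variable (m : (d → ℤ) → ℝ) {M : ℝ}

/-- The multiplied family `k ↦ m(k) f(k)`. [folklore] -/
def diagFun (f : SqFam d) : (d → ℤ) → EuclideanSpace ℂ d := fun k => (m k : ℂ) • f k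

/-- Bounded multipliers preserve square summability. [folklore] -/
theorem summable_sq_diagFun (hm : ∀ k, |m k| ≤ M) (f : SqFam d) : Summable fun k => ‖diagFun m f k‖ ^ 2 := by
  have hM : 0 ≤ M := (abs_nonneg _).trans (hm 0)
  refine (Summable.of_nonneg_of_le (fun k => sq_nonneg _) (fun k => ?_) ((summable_norm_sq f).mul_left (M ^ 2)))
  rw [diagFun, norm_smul, mul_pow, Complex.norm_real, Real.norm_eq_abs]
  exact mul_le_mul_of_nonneg_right (pow_le_pow_left₀ (abs_nonneg _) (hm k) 2) (sq_nonneg _)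

/-- The diagonal multiplier as a linear map. [folklore] -/
def diagₗ (hm : ∀ k, |m k| ≤ M) : SqFam d →ₗ[ℝ] SqFam d where
  toFun f := mk (diagFun m f) (summable_sq_diagFun m hm f)
  map_add' f g := by ext k; simp [diagFun, smul_add]
  map_smul' c f := by ext k; simp [diagFun, mul_left_comm]

/-- Coefficients of the multiplied element. [folklore] -/
theorem diagₗ_apply (hm : ∀ k, |m k| ≤ M) (f : SqFam d) (k : d → ℤ) : diagₗ m hm f k = (m k : ℂ) • f k := rfl

/-- **Norm identity**: `‖diag m f‖² = ∑_k m(k)² ‖f k‖²`. [folklore] -/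
theorem hasSum_norm_sq_diagₗ (hm : ∀ k, |m k| ≤ M) (f : SqFam d) :
    HasSum (fun k => m k ^ 2 * ‖f k‖ ^ 2) (‖diagₗ m hm f‖ ^ 2) := by
  have h := hasSum_norm_sq (diagₗ m hm f)
  refine h.congr_fun fun k => ?_
  rw [diagₗ_apply, norm_smul, mul_pow, Complex.norm_real, Real.norm_eq_abs, sq_abs]

/-- **Norm bound**: `‖diag m f‖ ≤ M ‖f‖`. [folklore] -/
theorem norm_diagₗ_le (hm : ∀ k, |m k| ≤ M) (f : SqFam d) : ‖diagₗ m hm f‖ ≤ M * ‖f‖ := by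
  have hM : 0 ≤ M := (abs_nonneg _).trans (hm 0)
  have h1 : ‖diagₗ m hm f‖ ^ 2 ≤ (M * ‖f‖) ^ 2 := by
    rw [mul_pow]
    refine hasSum_le (fun k => ?_) (hasSum_norm_sq_diagₗ m hm f) ((hasSum_norm_sq f).mul_left (M ^ 2))
    exact mul_le_mul_of_nonneg_right (by rw [← sq_abs]; exact pow_le_pow_left₀ (abs_nonneg _) (hm k) 2) (sq_nonneg _)
  exact (pow_le_pow_iff_left₀ (norm_nonneg _) (by positivity) two_ne_zero).1 h1

/-- **The diagonal multiplier** `diag m : f ↦ (m(k) f(k))_k` by a bounded real symbol, as a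
continuous linear map of the real Hilbert space `ℓ²(ℤ^d; ℂ^d)`. [folklore] -/
def diag (hm : ∀ k, |m k| ≤ M) : SqFam d →L[ℝ] SqFam d :=
  (diagₗ m hm).mkContinuous M (norm_diagₗ_le m hm)

/-- Coefficients of `diag m f`. [folklore] -/
@[simp] theorem diag_apply (hm : ∀ k, |m k| ≤ M) (f : SqFam d) (k : d → ℤ) : diag m hm f k = (m k : ℂ) • f k := rfl

/-- `‖diag m f‖ ≤ M ‖f‖`. [folklore] -/
theorem norm_diag_le (hm : ∀ k, |m k| ≤ M) (f : SqFam d) : ‖diag m hm f‖ ≤ M * ‖f‖ := norm_diagₗ_le m hm f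

/-- `‖diag m f‖² = ∑ m(k)² ‖f k‖²`. [folklore] -/
theorem hasSum_norm_sq_diag (hm : ∀ k, |m k| ≤ M) (f : SqFam d) :
    HasSum (fun k => m k ^ 2 * ‖f k‖ ^ 2) (‖diag m hm f‖ ^ 2) := hasSum_norm_sq_diagₗ m hm f

variable {m}

/-- **Composition of multipliers** is the multiplier by the product symbol. [folklore] -/
theorem diag_diag {m' : (d → ℤ) → ℝ} {M' : ℝ} (hm : ∀ k, |m k| ≤ M) (hm' : ∀ k, |m' k| ≤ M')
    (hmm' : ∀ k, |m k * m' k| ≤ M * M') (f : SqFam d) :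
    diag m hm (diag m' hm' f) = diag (fun k => m k * m' k) hmm' f := by
  ext k
  simp [smul_smul]

/-- Multipliers with the same symbol agree (the bound is irrelevant). [folklore] -/
theorem diag_congr {M' : ℝ} (hm : ∀ k, |m k| ≤ M) (hm' : ∀ k, |m k| ≤ M') (f : SqFam d) :
    diag m hm f = diag m hm' f := by
  ext k; rfl

/-- The multiplier by `1` is the identity. [folklore] -/
theorem diag_one (h : ∀ k : d → ℤ, |(fun _ => (1 : ℝ)) k| ≤ 1) (f : SqFam d) : diag (fun _ => (1 : ℝ)) h f = f := by
  ext k; simp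

/-- **A non-vanishing symbol gives an injective multiplier.** [folklore] -/
theorem diag_injective (hm : ∀ k, |m k| ≤ M) (h0 : ∀ k, m k ≠ 0) : Function.Injective (diag m hm) := by
  intro f g hfg
  refine SqFam.ext fun k => ?_
  have h := congrArg (fun h : SqFam d => h k) hfg
  simp only [diag_apply] at h
  exact smul_right_injective (EuclideanSpace ℂ d) (show (m k : ℂ) ≠ 0 by exact_mod_cast h0 k) h

end Diag

end SqFam

/-! ### The conjugation-symmetric subspace -/

variable {d}

/-- **The real subspace of conjugation-symmetric families** `f(-k) = conj f(k)` (the Fourier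
coefficient families of real vector fields, `Torus.isConjSymm_mFourierCoeff`). [folklore] -/
def symL2 (d : Type u) [Fintype d] : Submodule ℝ (SqFam d) where
  carrier := {f | IsConjSymm (f : (d → ℤ) → EuclideanSpace ℂ d)}
  zero_mem' := fun k => by rw [SqFam.zero_apply, SqFam.zero_apply, EuclideanSpace.conjVec_zero]
  add_mem' := by
    intro f g hf hg k
    simp only [SqFam.add_apply, hf k, hg k, EuclideanSpace.conjVec_add]
  smul_mem' := by
    intro c f hf k
    simp only [SqFam.smul_apply, hf k, EuclideanSpace.conjVec_smul, Complex.conj_ofReal]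

/-- Membership in `symL2`. [folklore] -/
theorem mem_symL2_iff {f : SqFam d} : f ∈ symL2 d ↔ ∀ k, f (-k) = EuclideanSpace.conjVec (f k) := Iff.rfl

/-- **`symL2` is closed** (the evaluations are continuous). [folklore] -/
theorem isClosed_symL2 : IsClosed ((symL2 d : Submodule ℝ (SqFam d)) : Set (SqFam d)) := by
  have h : ((symL2 d : Submodule ℝ (SqFam d)) : Set (SqFam d)) =
      ⋂ k : d → ℤ, {f : SqFam d | f (-k) = EuclideanSpace.conjVec (f k)} := by
    ext f
    simp only [SetLike.mem_coe, mem_symL2_iff, Set.mem_iInter, Set.mem_setOf_eq]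
  rw [h]
  refine isClosed_iInter fun k => isClosed_eq (SqFam.continuous_apply (-k)) ?_
  exact EuclideanSpace.conjVecL.continuous.comp (SqFam.continuous_apply k)

/-- **The real Hilbert space `SymL2 d`** of conjugation-symmetric square-summable families.
[folklore] -/
abbrev SymL2 (d : Type u) [Fintype d] : Type u := ↥(symL2 d)

/-- `SymL2` is complete (a closed subspace of `ℓ²`). [folklore] -/
instance : CompleteSpace (SymL2 d) := isClosed_symL2.completeSpace_coe

/-- `SymL2` is separable (a subspace of the separable metric space `ℓ²`). [folklore] -/
instance : SeparableSpace (SymL2 d) :=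
  (IsSeparable.of_separableSpace ((symL2 d : Submodule ℝ (SqFam d)) : Set (SqFam d))).separableSpace

namespace SymL2

/-- The coefficient family of an element of `SymL2`. [folklore] -/
instance : CoeFun (SymL2 d) fun _ => (d → ℤ) → EuclideanSpace ℂ d := ⟨fun f => ((f : SqFam d) : (d → ℤ) → _)⟩

/-- Unfolding the coercion. [folklore] -/
theorem coe_apply (f : SymL2 d) (k : d → ℤ) : f k = (f : SqFam d) k := rfl

/-- Elements of `SymL2` are conjugation symmetric. [folklore] -/
theorem isConjSymm (f : SymL2 d) : IsConjSymm (f : (d → ℤ) → EuclideanSpace ℂ d) := f.2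

/-- `f(-k) = conj f(k)`. [folklore] -/
theorem apply_neg (f : SymL2 d) (k : d → ℤ) : f (-k) = EuclideanSpace.conjVec (f k) := f.2 k

/-- Extensionality through coefficients. [folklore] -/
@[ext] theorem ext {f g : SymL2 d} (h : ∀ k, f k = g k) : f = g := Subtype.ext (SqFam.ext h)

/-- The norm through coefficients. [folklore] -/
theorem hasSum_norm_sq (f : SymL2 d) : HasSum (fun k => ‖f k‖ ^ 2) (‖f‖ ^ 2) := SqFam.hasSum_norm_sq (f : SqFam d)

/-- The inner product through coefficients. [folklore] -/
theorem hasSum_inner (f g : SymL2 d) : HasSum (fun k => RCLike.re (⟪f k, g k⟫_ℂ)) ⟪f, g⟫_ℝ :=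
  SqFam.hasSum_inner (f : SqFam d) (g : SqFam d)

/-- Each coefficient is bounded by the norm. [folklore] -/
theorem norm_apply_le (f : SymL2 d) (k : d → ℤ) : ‖f k‖ ≤ ‖f‖ := SqFam.norm_apply_le (f : SqFam d) k

/-- The evaluations are continuous on `SymL2`. [folklore] -/
theorem continuous_apply (k : d → ℤ) : Continuous fun f : SymL2 d => f k :=
  (SqFam.continuous_apply k).comp continuous_subtype_val

/-- **Elements from conjugation-symmetric square-summable families.** [folklore] -/
def mk (c : (d → ℤ) → EuclideanSpace ℂ d) (hc : Summable fun k => ‖c k‖ ^ 2) (hs : IsConjSymm c) : SymL2 d :=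
  ⟨SqFam.mk c hc, hs⟩

/-- Coefficients of `mk`. [folklore] -/
@[simp] theorem mk_apply (c : (d → ℤ) → EuclideanSpace ℂ d) (hc : Summable fun k => ‖c k‖ ^ 2) (hs : IsConjSymm c)
    (k : d → ℤ) : mk c hc hs k = c k := rfl

/-- Coefficients of sums, differences, scalar multiples. [folklore] -/
@[simp] theorem add_apply (f g : SymL2 d) (k : d → ℤ) : (f + g) k = f k + g k := rfl

/-- Coefficients of differences. [folklore] -/
@[simp] theorem sub_apply (f g : SymL2 d) (k : d → ℤ) : (f - g) k = f k - g k := rfl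

/-- Coefficients of zero. [folklore] -/
@[simp] theorem zero_apply (k : d → ℤ) : (0 : SymL2 d) k = 0 := rfl

/-- Coefficients of real multiples. [folklore] -/
@[simp] theorem smul_apply (c : ℝ) (f : SymL2 d) (k : d → ℤ) : (c • f) k = (c : ℂ) • f k := rfl

/-- Coefficients of finite sums. [folklore] -/
@[simp] theorem sum_apply {ι : Type*} (s : Finset ι) (f : ι → SymL2 d) (k : d → ℤ) :
    (∑ i ∈ s, f i) k = ∑ i ∈ s, f i k := by
  rw [coe_apply, Submodule.coe_sum, SqFam.sum_apply]

/-! ### Even multipliers on `SymL2` -/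

section Diag

variable (m : (d → ℤ) → ℝ) {M : ℝ}

/-- Even real multipliers preserve conjugation symmetry. [folklore] -/
theorem diag_mem (hm : ∀ k, |m k| ≤ M) (heven : ∀ k, m (-k) = m k) {f : SqFam d} (hf : f ∈ symL2 d) :
    SqFam.diag m hm f ∈ symL2 d := fun k => by
  simp only [SqFam.diag_apply, heven k, hf k, EuclideanSpace.conjVec_smul, Complex.conj_ofReal]

/-- **The diagonal multiplier on `SymL2`** by a bounded even real symbol. [folklore] -/
def diag (hm : ∀ k, |m k| ≤ M) (heven : ∀ k, m (-k) = m k) : SymL2 d →L[ℝ] SymL2 d :=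
  ((SqFam.diag m hm).comp (symL2 d).subtypeL).codRestrict (symL2 d) fun f => diag_mem m hm heven f.2

/-- Coefficients of `diag m f`. [folklore] -/
@[simp] theorem diag_apply (hm : ∀ k, |m k| ≤ M) (heven : ∀ k, m (-k) = m k) (f : SymL2 d) (k : d → ℤ) :
    diag m hm heven f k = (m k : ℂ) • f k := rfl

/-- The underlying `SqFam` element of `diag m f`. [folklore] -/
theorem coe_diag (hm : ∀ k, |m k| ≤ M) (heven : ∀ k, m (-k) = m k) (f : SymL2 d) :
    ((diag m hm heven f : SymL2 d) : SqFam d) = SqFam.diag m hm (f : SqFam d) := rfl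

/-- `‖diag m f‖ ≤ M ‖f‖`. [folklore] -/
theorem norm_diag_le (hm : ∀ k, |m k| ≤ M) (heven : ∀ k, m (-k) = m k) (f : SymL2 d) :
    ‖diag m hm heven f‖ ≤ M * ‖f‖ := SqFam.norm_diag_le m hm (f : SqFam d)

/-- `‖diag m f‖² = ∑ m(k)² ‖f k‖²`. [folklore] -/
theorem hasSum_norm_sq_diag (hm : ∀ k, |m k| ≤ M) (heven : ∀ k, m (-k) = m k) (f : SymL2 d) :
    HasSum (fun k => m k ^ 2 * ‖f k‖ ^ 2) (‖diag m hm heven f‖ ^ 2) := SqFam.hasSum_norm_sq_diag m hm (f : SqFam d)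

variable {m}

/-- Composition of even multipliers. [folklore] -/
theorem diag_diag {m' : (d → ℤ) → ℝ} {M' : ℝ} (hm : ∀ k, |m k| ≤ M) (heven : ∀ k, m (-k) = m k)
    (hm' : ∀ k, |m' k| ≤ M') (heven' : ∀ k, m' (-k) = m' k) (hmm' : ∀ k, |m k * m' k| ≤ M * M') (f : SymL2 d) :
    diag m hm heven (diag m' hm' heven' f) =
      diag (fun k => m k * m' k) hmm' (fun k => by rw [heven, heven']) f := by
  ext k
  simp [smul_smul]

/-- Multipliers with the same symbol agree. [folklore] -/
theorem diag_congr {M' : ℝ} (hm : ∀ k, |m k| ≤ M) (hm' : ∀ k, |m k| ≤ M') (heven : ∀ k, m (-k) = m k) (f : SymL2 d) :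
    diag m hm heven f = diag m hm' heven f := by
  ext k; rfl

/-- A non-vanishing even symbol gives an injective multiplier. [folklore] -/
theorem diag_injective (hm : ∀ k, |m k| ≤ M) (heven : ∀ k, m (-k) = m k) (h0 : ∀ k, m k ≠ 0) :
    Function.Injective (diag m hm heven) := by
  intro f g hfg
  apply Subtype.ext
  exact SqFam.diag_injective hm h0 (congrArg Subtype.val hfg)

end Diag

/-! ### Truncation, finitely supported elements, density -/

/-- **Finitely supported conjugation-symmetric families** give elements of `SymL2`. [folklore] -/
def ofFinSupp (c : (d → ℤ) → EuclideanSpace ℂ d) (S : Finset (d → ℤ)) (hS : ∀ k ∉ S, c k = 0) (hs : IsConjSymm c) :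
    SymL2 d :=
  mk c (SqFam.summable_sq_of_support_subset hS) hs

/-- Coefficients of `ofFinSupp`. [folklore] -/
@[simp] theorem ofFinSupp_apply (c : (d → ℤ) → EuclideanSpace ℂ d) (S : Finset (d → ℤ)) (hS : ∀ k ∉ S, c k = 0)
    (hs : IsConjSymm c) (k : d → ℤ) : ofFinSupp c S hS hs k = c k := rfl

section Trunc

variable [DecidableEq d]

/-- The truncation symbol `1_{freqBall N}`. [folklore] -/
def truncSymbol (N : ℕ) (k : d → ℤ) : ℝ := if k ∈ freqBall N then 1 else 0

/-- The truncation symbol is bounded by `1`. [folklore] -/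
theorem abs_truncSymbol_le (N : ℕ) (k : d → ℤ) : |truncSymbol N k| ≤ 1 := by
  unfold truncSymbol; split_ifs <;> simp

/-- The truncation symbol is even. [folklore] -/
theorem truncSymbol_neg (N : ℕ) (k : d → ℤ) : truncSymbol N (-k) = truncSymbol N k := by
  simp only [truncSymbol, neg_mem_freqBall]

/-- **Fourier truncation** `trunc N f = 1_{|k| ≤ N} f`. [folklore] -/
def trunc (N : ℕ) : SymL2 d →L[ℝ] SymL2 d := diag (truncSymbol N) (abs_truncSymbol_le N) (truncSymbol_neg N)

/-- Coefficients of the truncation. [folklore] -/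
theorem trunc_apply (N : ℕ) (f : SymL2 d) (k : d → ℤ) : trunc N f k = if k ∈ freqBall N then f k else 0 := by
  rw [trunc, diag_apply, truncSymbol]
  split_ifs <;> simp

/-- The truncation does not increase the norm. [folklore] -/
theorem norm_trunc_le (N : ℕ) (f : SymL2 d) : ‖trunc N f‖ ≤ ‖f‖ := by
  have := norm_diag_le (truncSymbol N) (abs_truncSymbol_le N) (truncSymbol_neg N) f
  rwa [one_mul] at this

/-- The truncation vanishes off the ball. [folklore] -/
theorem trunc_apply_of_not_mem (N : ℕ) (f : SymL2 d) {k : d → ℤ} (hk : k ∉ freqBall N) : trunc N f k = 0 := by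
  rw [trunc_apply, if_neg hk]

/-- The truncation is the identity on the ball. [folklore] -/
theorem trunc_apply_of_mem (N : ℕ) (f : SymL2 d) {k : d → ℤ} (hk : k ∈ freqBall N) : trunc N f k = f k := by
  rw [trunc_apply, if_pos hk]

/-- `‖f - trunc N f‖² = ∑_{|k| > N} ‖f k‖²`. [folklore] -/
theorem hasSum_norm_sq_sub_trunc (N : ℕ) (f : SymL2 d) :
    HasSum (fun k => if k ∈ freqBall N then (0 : ℝ) else ‖f k‖ ^ 2) (‖f - trunc N f‖ ^ 2) := by
  refine (hasSum_norm_sq (f - trunc N f)).congr_fun fun k => ?_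
  rw [sub_apply, trunc_apply]
  split_ifs <;> simp

/-- **`trunc N f → f`** as `N → ∞`. [folklore] -/
theorem tendsto_trunc (f : SymL2 d) : Tendsto (fun N => trunc N f) atTop (𝓝 f) := by
  -- the squared distance is the tail sum, which tends to zero
  have htail : Tendsto (fun N => ‖f - trunc N f‖ ^ 2) atTop (𝓝 0) := by
    have hs : Summable fun k => ‖f k‖ ^ 2 := (hasSum_norm_sq f).summable
    have h1 : Tendsto (fun s : Finset (d → ℤ) => ∑' k : {k // k ∉ s}, ‖f (k : d → ℤ)‖ ^ 2) atTop (𝓝 0) :=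
      tendsto_tsum_compl_atTop_zero fun k => ‖f k‖ ^ 2
    have h2 := h1.comp tendsto_freqBall_atTop
    refine h2.congr fun N => ?_
    simp only [Function.comp_apply]
    rw [← (hasSum_norm_sq_sub_trunc N f).tsum_eq]
    refine (_root_.tsum_subtype ({k | k ∉ freqBall N} : Set (d → ℤ)) (fun k => ‖f k‖ ^ 2)).trans ?_
    refine tsum_congr fun k => ?_
    simp only [Set.indicator, Set.mem_setOf_eq]
    split_ifs <;> simp_all
  have hnorm : Tendsto (fun N => ‖f - trunc N f‖) atTop (𝓝 0) := by
    have h := htail.sqrt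
    rw [Real.sqrt_zero] at h
    exact h.congr fun N => Real.sqrt_sq (norm_nonneg _)
  rw [tendsto_iff_norm_sub_tendsto_zero]
  exact hnorm.congr fun N => norm_sub_rev _ _

/-- **Every non-vanishing even multiplier has dense range** (it hits every truncation).
[folklore] -/
theorem denseRange_diag {m : (d → ℤ) → ℝ} {M : ℝ} (hm : ∀ k, |m k| ≤ M) (heven : ∀ k, m (-k) = m k)
    (h0 : ∀ k, m k ≠ 0) : DenseRange (diag m hm heven) := by
  intro g
  -- `trunc N g` is in the range
  have hmem : ∀ N, trunc N g ∈ Set.range (diag m hm heven) := by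
    intro N
    set c : (d → ℤ) → EuclideanSpace ℂ d := fun k => if k ∈ freqBall N then ((m k)⁻¹ : ℂ) • g k else 0 with hc
    have hcS : ∀ k ∉ freqBall N, c k = 0 := fun k hk => by simp [hc, hk]
    have hcs : IsConjSymm c := fun k => by
      simp only [hc, neg_mem_freqBall]
      split_ifs with h
      · rw [heven, g.apply_neg, EuclideanSpace.conjVec_smul, map_inv₀, Complex.conj_ofReal]
      · exact EuclideanSpace.conjVec_zero.symm
    refine ⟨ofFinSupp c (freqBall N) hcS hcs, ?_⟩
    ext k
    rw [diag_apply, ofFinSupp_apply, trunc_apply]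
    simp only [hc]
    split_ifs with h
    · rw [smul_smul, mul_inv_cancel₀ (by exact_mod_cast h0 k), one_smul]
    · rw [smul_zero]
  exact mem_closure_of_tendsto (tendsto_trunc g) (Eventually.of_forall hmem)

end Trunc

end SymL2

end Torus

end Literature.Analysis.FunctionSpaces
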